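import Mathlib.Tactic
import HarnessLib

/-!
# (BG∞) ∕ UV3-NODE §116 (G4)-CORE — THE MISSED-CAP PIGEONHOLE, GENERIC: a finite family covered by `k` half-radius patches misses an `r`-cap around some point of
# any `3r`-separated set with more than `k` points

Cell `ym3-torus` (YM ladder rung R3 = continuum `SU(2)` Yang–Mills on the three-torus — a RUNG: NOT d = 4, NOT infinite volume, NOT a mass gap, NOT Clay).
LEAD-20520 `ym-ust-20520-w3` (gen 29); explicit-unit helper on the crux `stmt-QuantumFields-20520` (`--supports`, count-neutral).  DEFINITION-FREE, Mathlib-only.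

WHAT.  The combinatorial half of §116.4 (G4) `exists_far_point` (px19 g25's (BG∞) plan of record, desk RULING №123; px5 g24's «pure `Finset` pigeonhole» cut),
stated for an ARBITRARY symmetric «distance» `d : X → X → ℝ` obeying the triangle inequality (so it applies verbatim to the arc `‖logVec (su2Quat (p⁻¹ * q))‖`, to
`dist1`, or to a Mathlib `dist`): ★★ `exists_far_point_of_cover` — if every `φ i` lies within `r∕2` of some patch centre `q j` (`j : κ`, finitely many), and
`P` is a finite `3r`-separated set with `Fintype.card κ < P.card`, then some `p ∈ P` has `r ≤ d p (φ i)` for ALL `i`.  Proof: a «bad» `p` (some `φ i` closer than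
`r`) is within `3r∕2` of some centre; two bad points sharing a centre are `< 3r` apart, hence equal; so bad points inject into `κ` — too few.  The GEOMETRIC half
(a `3r`-separated set of `≥ 0.15∕r³` points in `SU(2)`, and the patch count of a step-bounded grid map) stays with the (G4) holder.

HONEST FRAMING.  [folklore] finite combinatorics; nothing of Bałaban's; (BG∞)∕`hBG` a CONJECTURE under construction; GAP♯∘ ∕ S2β ∕ 20520 ∕ `YM3TorusSU2` NOT proved;
rung R3 — NOT d = 4, NOT infinite volume, NOT a mass gap, NOT Clay.  Sorry-free; axioms standard; default heartbeats.
-/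

set_option autoImplicit false

namespace Summit.QuantumFields.YangMills.Theorems.FluctuationComparisonRegPrIntLS2BetaFarPointPigeonhole

/-- ★★ **THE MISSED-CAP PIGEONHOLE.**  For a symmetric `d` with the triangle inequality: a family `φ` covered by the `r∕2`-patches around finitely many centres
`q : κ → X` misses the `r`-cap around some point of every finite `3r`-separated set `P` with `Fintype.card κ < P.card`. [folklore] -/
theorem exists_far_point_of_cover {X ι κ : Type*} [Fintype κ] (d : X → X → ℝ)
    (hsymm : ∀ x y, d x y = d y x) (htri : ∀ x y z, d x z ≤ d x y + d y z)
    (φ : ι → X) (q : κ → X) {r : ℝ} (hcover : ∀ i, ∃ j, d (φ i) (q j) ≤ r / 2)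
    (P : Finset X) (hsep : ∀ p ∈ P, ∀ p' ∈ P, p ≠ p' → 3 * r ≤ d p p') (hcard : Fintype.card κ < P.card) :
    ∃ p ∈ P, ∀ i, r ≤ d p (φ i) := by
  classical
  by_contra hbad
  simp only [not_exists, not_and, not_forall, not_le] at hbad
  -- every point of `P` is bad: choose a witness `i p` and a centre `j p` within `3r∕2`
  have hnear : ∀ p ∈ P, ∃ j : κ, d p (q j) < 3 * r / 2 := by
    intro p hp
    obtain ⟨i, hi⟩ := hbad p hp
    obtain ⟨j, hj⟩ := hcover i
    exact ⟨j, by linarith [htri p (φ i) (q j)]⟩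
  have hκ : Nonempty κ := by
    obtain ⟨p, hp⟩ := Finset.card_pos.1 (by omega : 0 < P.card)
    obtain ⟨j, _⟩ := hnear p hp
    exact ⟨j⟩
  choose! jc hjc using hnear
  -- `jc` is injective on `P`
  have hinj : Set.InjOn jc ↑P := by
    intro p hp p' hp' hjj
    by_contra hne
    have h3 : 3 * r ≤ d p p' := hsep p hp p' hp' hne
    have h1 : d p (q (jc p)) < 3 * r / 2 := hjc p hp
    have h2 : d p' (q (jc p')) < 3 * r / 2 := hjc p' hp'
    rw [← hjj] at h2
    have := htri p (q (jc p)) p'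
    rw [hsymm (q (jc p)) p'] at this
    linarith
  -- too many points
  have hle : P.card ≤ Fintype.card κ := by
    calc P.card = (P.image jc).card := (Finset.card_image_of_injOn hinj).symm
      _ ≤ (Finset.univ : Finset κ).card := Finset.card_le_card (Finset.subset_univ _)
      _ = Fintype.card κ := Finset.card_univ
  omega

/-- The same with the cover given as a function `c : ι → κ` (each `φ i` in the patch of `c i`). [folklore] -/
theorem exists_far_point_of_patches {X ι κ : Type*} [Fintype κ] (d : X → X → ℝ)
    (hsymm : ∀ x y, d x y = d y x) (htri : ∀ x y z, d x z ≤ d x y + d y z)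
    (φ : ι → X) (q : κ → X) (c : ι → κ) {r : ℝ} (hcover : ∀ i, d (φ i) (q (c i)) ≤ r / 2)
    (P : Finset X) (hsep : ∀ p ∈ P, ∀ p' ∈ P, p ≠ p' → 3 * r ≤ d p p') (hcard : Fintype.card κ < P.card) :
    ∃ p ∈ P, ∀ i, r ≤ d p (φ i) :=
  exists_far_point_of_cover d hsymm htri φ q (fun i => ⟨c i, hcover i⟩) P hsep hcard

end Summit.QuantumFields.YangMills.Theorems.FluctuationComparisonRegPrIntLS2BetaFarPointPigeonhole
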